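import Summits.AnomalousDissipation.AnomalousDissipation.Theorems.SawtoothPulseCascadeK1LocalisedCascadeThinChannels

/-!
# K1loc, line `Spectral` — S-D (thin start): THE CHANNEL BUDGET BEHIND `hiter` (symbol algebra)

Helper file of the prover lane on the crux `K1LocalisedCascade` (stmt-AnomalousDissipation-19491), route
`SawtoothPulseCascade` (glue seat k1loc-p3; S-B ↔ S-D hand-over).  The hypothesis `hiter` of
`K1Ledger.From.k1Localised_of_thin_iterate_bound` (`…LedgerThinClose`) asks, for every phase `n ≥ i₁`,
`√(Σ' k, μ_n(k)²‖𝓕a_n(k)‖²) ≤ q` with the literal thin product start symbol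
`μ_n = 1 − sT((|k₀|−L)/(L/250))·(1 − sT((γ|k₁| − 13/10|k₀|)/(L/20)))·(1 − sT((|k₀|−R)/w))(1 − sT((|k₁|−R)/w))`, `L = c(γ²−3)ⁿ`.
* `symProdS_sq_le_four_channels` / `tsum_symProdS_sq_le_four_channels`: the SHARP split
  `μ² ≤ μ ≤ [|k₀| ≤ (1+ε_s)L] + [a|k₀| ≤ γ|k₁|] + [R ≤ |k₀|] + [R ≤ |k₁|]` (factor `1`; `…ThinChannels` had `3`);
* `sqrt_tsum_symProdS_sq_le_of_budget`: in the literals of `hiter` (`ε_s = 1/250`, `ε_a = 1/20`, `a = 13/10`), channel bounds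
  `strip ≤ s`, `off-cone ≤ o`, `far₀ ≤ f₀`, `far₁ ≤ f₁` with `s + o + f₀ + f₁ ≤ q²` give `√(Σ' μ²c) ≤ q`;
* `integral_sq_sub_lineAvg_le` (generic `d`): for `|θ| ≤ B` and a measurable set `G` of points whose segment
  `{x + u·v : |u| ≤ 1/(2M)}` is flat (`θ(x + u·v) = θ(x)`), `∫(θ − M∫_{−1/(2M)}^{1/(2M)} θ(· + u·v)du)² ≤ (2B)²·|Gᶜ|` — the crest
  deviation of `…LineAverage` is a CELL-END / rounding-zone AREA; `integral_sq_sub_lineAvg_le_of_approx`: the same with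
  `|θ(x + u·v) − θ(x)| ≤ η` on `G` (bound `η² + (2B)²|Gᶜ|`) — the Gaussian-rounded profile `tri ⋆ gauss_δ` has no exact cells.
The window form of every channel (strip via `…StripAverage`, off-cone via `…LineAverage`, far via `…FarModes`) is assembled
in the companion file `…ThinWindows`.
WHAT THIS IS NOT: no statement about the cascade itself.
[cite: ElgindiLissMattingly2025, §1.2.2] [cite: Grafakos2014, Prop. 3.2.7 (3)] [problem: turb]
-/

-- `Summit.<Summit>.<Problem>`: single-conjunct summit, the duplicate namespace segment is deliberate.
set_option linter.dupNamespace false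

noncomputable section

namespace Summit.AnomalousDissipation.AnomalousDissipation.Theorems.SawtoothPulseCascade.K1Start

open MeasureTheory Set Filter Topology UnitAddTorus Function
open Literature.Analysis.FunctionSpaces Literature.Analysis.FunctionSpaces.Torus

/-! ## §0 The sharp channel split (factor `1`: `μ² ≤ μ`) -/

/-- **The start symbol squared is at most the SUM of the channel indicators** (sharpening of
`symProdS_sq_le_three_channels`, factor `1` instead of `3`, since `0 ≤ μ ≤ 1` gives `μ² ≤ μ ≤ (1−x)+(1−y)+(1−z)`):
`μ(k)² ≤ [|k₀| ≤ (1+ε_s)L] + [a|k₀| ≤ γ|k₁|] + ([R ≤ |k₀|] + [R ≤ |k₁|])`. [cite: ElgindiLissMattingly2025, §1.2.2] -/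
theorem symProdS_sq_le_four_channels (γ a : ℝ) {εs εa L R w : ℝ} (hεs : 0 < εs) (hεa : 0 < εa) (hL : 0 < L) (hw : 0 < w)
    (kh kv : ℤ) :
    (1 - Real.smoothTransition ((|(kh : ℝ)| - L) / (εs * L)) *
        (1 - Real.smoothTransition ((γ * |(kv : ℝ)| - a * |(kh : ℝ)|) / (εa * L))) *
      ((1 - Real.smoothTransition ((|(kh : ℝ)| - R) / w)) * (1 - Real.smoothTransition ((|(kv : ℝ)| - R) / w)))) ^ 2 ≤
      (if |(kh : ℝ)| ≤ (1 + εs) * L then (1 : ℝ) else 0) + (if a * |(kh : ℝ)| ≤ γ * |(kv : ℝ)| then (1 : ℝ) else 0) +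
        ((if R ≤ |(kh : ℝ)| then (1 : ℝ) else 0) + (if R ≤ |(kv : ℝ)| then (1 : ℝ) else 0)) := by
  set x : ℝ := Real.smoothTransition ((|(kh : ℝ)| - L) / (εs * L)) with hx
  set y : ℝ := 1 - Real.smoothTransition ((γ * |(kv : ℝ)| - a * |(kh : ℝ)|) / (εa * L)) with hy
  set z : ℝ := (1 - Real.smoothTransition ((|(kh : ℝ)| - R) / w)) * (1 - Real.smoothTransition ((|(kv : ℝ)| - R) / w))
    with hz
  have hx0 : 0 ≤ x := Real.smoothTransition.nonneg _
  have hx1 : x ≤ 1 := Real.smoothTransition.le_one _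
  have hy0 : 0 ≤ y := by
    rw [hy]; linarith [Real.smoothTransition.le_one ((γ * |(kv : ℝ)| - a * |(kh : ℝ)|) / (εa * L))]
  have hy1 : y ≤ 1 := by
    rw [hy]; linarith [Real.smoothTransition.nonneg ((γ * |(kv : ℝ)| - a * |(kh : ℝ)|) / (εa * L))]
  have hu0 : 0 ≤ 1 - Real.smoothTransition ((|(kh : ℝ)| - R) / w) := by
    linarith [Real.smoothTransition.le_one ((|(kh : ℝ)| - R) / w)]
  have hu1 : 1 - Real.smoothTransition ((|(kh : ℝ)| - R) / w) ≤ 1 := by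
    linarith [Real.smoothTransition.nonneg ((|(kh : ℝ)| - R) / w)]
  have hv0 : 0 ≤ 1 - Real.smoothTransition ((|(kv : ℝ)| - R) / w) := by
    linarith [Real.smoothTransition.le_one ((|(kv : ℝ)| - R) / w)]
  have hv1 : 1 - Real.smoothTransition ((|(kv : ℝ)| - R) / w) ≤ 1 := by
    linarith [Real.smoothTransition.nonneg ((|(kv : ℝ)| - R) / w)]
  have hz0 : 0 ≤ z := by rw [hz]; exact mul_nonneg hu0 hv0
  have hz1 : z ≤ 1 := by rw [hz]; exact mul_le_one₀ hu1 hv0 hv1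
  have hxyz1 : x * y * z ≤ 1 := mul_le_one₀ (mul_le_one₀ hx1 hy0 hy1) hz0 hz1
  have hxyz0 : 0 ≤ x * y * z := mul_nonneg (mul_nonneg hx0 hy0) hz0
  have hsq : (1 - x * y * z) ^ 2 ≤ 1 - x * y * z := by nlinarith
  have hsplit : 1 - x * y * z ≤ (1 - x) + (1 - y) + (1 - z) := one_sub_mul_three_le hx0 hx1 hy0 hy1 hz1
  -- the channel bounds, first powers
  have hA : 1 - x ≤ (if |(kh : ℝ)| ≤ (1 + εs) * L then (1 : ℝ) else 0) := by
    split_ifs with h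
    · linarith
    · have h1 : 1 ≤ (|(kh : ℝ)| - L) / (εs * L) := by
        rw [le_div_iff₀ (by positivity)]; nlinarith
      rw [hx, Real.smoothTransition.one_of_one_le h1]; norm_num
  have hB : 1 - y ≤ (if a * |(kh : ℝ)| ≤ γ * |(kv : ℝ)| then (1 : ℝ) else 0) := by
    split_ifs with h
    · linarith
    · have h1 : (γ * |(kv : ℝ)| - a * |(kh : ℝ)|) / (εa * L) ≤ 0 :=
        div_nonpos_of_nonpos_of_nonneg (by linarith [not_le.mp h]) (by positivity)
      rw [hy, Real.smoothTransition.zero_of_nonpos h1]; norm_num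
  have hC : 1 - z ≤ (if R ≤ |(kh : ℝ)| then (1 : ℝ) else 0) + (if R ≤ |(kv : ℝ)| then (1 : ℝ) else 0) := by
    by_cases h0 : R ≤ |(kh : ℝ)|
    · rw [if_pos h0]
      have h2 : (0 : ℝ) ≤ (if R ≤ |(kv : ℝ)| then (1 : ℝ) else 0) := by split_ifs <;> norm_num
      linarith
    · by_cases h1 : R ≤ |(kv : ℝ)|
      · rw [if_pos h1, if_neg h0]; linarith
      · rw [if_neg h0, if_neg h1]
        have e0 : Real.smoothTransition ((|(kh : ℝ)| - R) / w) = 0 :=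
          Real.smoothTransition.zero_of_nonpos (div_nonpos_of_nonpos_of_nonneg (by linarith [not_le.mp h0]) hw.le)
        have e1 : Real.smoothTransition ((|(kv : ℝ)| - R) / w) = 0 :=
          Real.smoothTransition.zero_of_nonpos (div_nonpos_of_nonpos_of_nonneg (by linarith [not_le.mp h1]) hw.le)
        rw [hz, e0, e1]; norm_num
  linarith

/-- **Sharp weighted channel split**: for non-negative summable `c`,
`Σ' k, μ(k)²c(k) ≤ Σ'[|k₀| ≤ (1+ε_s)L]c + Σ'[a|k₀| ≤ γ|k₁|]c + (Σ'[R ≤ |k₀|]c + Σ'[R ≤ |k₁|]c)` (factor `1`).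
[cite: ElgindiLissMattingly2025, §1.2.2] -/
theorem tsum_symProdS_sq_le_four_channels (γ a : ℝ) {εs εa L R w : ℝ} (hεs : 0 < εs) (hεa : 0 < εa) (hL : 0 < L)
    (hw : 0 < w) {c : (Fin 2 → ℤ) → ℝ} (hc : Summable c) (hc0 : ∀ k, 0 ≤ c k) :
    ∑' k : Fin 2 → ℤ, (1 - Real.smoothTransition ((|((k 0 : ℤ) : ℝ)| - L) / (εs * L)) *
        (1 - Real.smoothTransition ((γ * |((k 1 : ℤ) : ℝ)| - a * |((k 0 : ℤ) : ℝ)|) / (εa * L))) *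
        ((1 - Real.smoothTransition ((|((k 0 : ℤ) : ℝ)| - R) / w)) *
          (1 - Real.smoothTransition ((|((k 1 : ℤ) : ℝ)| - R) / w)))) ^ 2 * c k ≤
      ∑' k : Fin 2 → ℤ, (if |((k 0 : ℤ) : ℝ)| ≤ (1 + εs) * L then (1 : ℝ) else 0) * c k +
        ∑' k : Fin 2 → ℤ, (if a * |((k 0 : ℤ) : ℝ)| ≤ γ * |((k 1 : ℤ) : ℝ)| then (1 : ℝ) else 0) * c k +
        (∑' k : Fin 2 → ℤ, (if R ≤ |((k 0 : ℤ) : ℝ)| then (1 : ℝ) else 0) * c k +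
          ∑' k : Fin 2 → ℤ, (if R ≤ |((k 1 : ℤ) : ℝ)| then (1 : ℝ) else 0) * c k) := by
  have hsI : ∀ (p : (Fin 2 → ℤ) → Prop) [DecidablePred p], Summable fun k => (if p k then (1 : ℝ) else 0) * c k := by
    intro p _
    refine Summable.of_nonneg_of_le (fun k => mul_nonneg (by split_ifs <;> norm_num) (hc0 k)) (fun k => ?_) hc
    split_ifs <;> simp [hc0 k]
  have h1 := hsI (fun k => |((k 0 : ℤ) : ℝ)| ≤ (1 + εs) * L)
  have h2 := hsI (fun k => a * |((k 0 : ℤ) : ℝ)| ≤ γ * |((k 1 : ℤ) : ℝ)|)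
  have h3 := hsI (fun k => R ≤ |((k 0 : ℤ) : ℝ)|)
  have h4 := hsI (fun k => R ≤ |((k 1 : ℤ) : ℝ)|)
  rw [← (h3.hasSum.add h4.hasSum).tsum_eq, ← (h1.hasSum.add h2.hasSum).tsum_eq,
    ← ((h1.add h2).hasSum.add (h3.add h4).hasSum).tsum_eq]
  have hle : ∀ k : Fin 2 → ℤ, (1 - Real.smoothTransition ((|((k 0 : ℤ) : ℝ)| - L) / (εs * L)) *
        (1 - Real.smoothTransition ((γ * |((k 1 : ℤ) : ℝ)| - a * |((k 0 : ℤ) : ℝ)|) / (εa * L))) *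
        ((1 - Real.smoothTransition ((|((k 0 : ℤ) : ℝ)| - R) / w)) *
          (1 - Real.smoothTransition ((|((k 1 : ℤ) : ℝ)| - R) / w)))) ^ 2 * c k ≤
      (if |((k 0 : ℤ) : ℝ)| ≤ (1 + εs) * L then (1 : ℝ) else 0) * c k +
        (if a * |((k 0 : ℤ) : ℝ)| ≤ γ * |((k 1 : ℤ) : ℝ)| then (1 : ℝ) else 0) * c k +
        ((if R ≤ |((k 0 : ℤ) : ℝ)| then (1 : ℝ) else 0) * c k + (if R ≤ |((k 1 : ℤ) : ℝ)| then (1 : ℝ) else 0) * c k) := by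
    intro k
    have h := mul_le_mul_of_nonneg_right (symProdS_sq_le_four_channels γ a hεs hεa hL hw (R := R) (k 0) (k 1)) (hc0 k)
    linarith
  have hnn : ∀ k : Fin 2 → ℤ, 0 ≤ (1 - Real.smoothTransition ((|((k 0 : ℤ) : ℝ)| - L) / (εs * L)) *
        (1 - Real.smoothTransition ((γ * |((k 1 : ℤ) : ℝ)| - a * |((k 0 : ℤ) : ℝ)|) / (εa * L))) *
        ((1 - Real.smoothTransition ((|((k 0 : ℤ) : ℝ)| - R) / w)) *
          (1 - Real.smoothTransition ((|((k 1 : ℤ) : ℝ)| - R) / w)))) ^ 2 * c k :=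
    fun k => mul_nonneg (sq_nonneg _) (hc0 k)
  exact Summable.tsum_le_tsum hle (Summable.of_nonneg_of_le hnn hle ((h1.add h2).add (h3.add h4)))
    ((h1.add h2).add (h3.add h4))

/-! ## §1 The four-channel budget gives `hiter` -/

/-- **Budget form of `hiter`**: if the strip, off-cone and far channels of a nonnegative summable weight `c` are bounded by
`s, o, f₀, f₁` with `s + o + f₀ + f₁ ≤ q²`, `q ≥ 0`, then `√(Σ' μ²c) ≤ q` for the thin product start symbol `μ`
(`εs = 1/250`, `εa = 1/20`, aperture `13/10`). [cite: Grafakos2014, Prop. 3.2.7 (3)] -/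
theorem sqrt_tsum_symProdS_sq_le_of_budget (γ : ℝ) {L R w : ℝ} (hL : 0 < L) (hw : 0 < w) {q s o f₀ f₁ : ℝ} (hq : 0 ≤ q)
    {c : (Fin 2 → ℤ) → ℝ} (hc : Summable c) (hc0 : ∀ k, 0 ≤ c k)
    (hs : ∑' k : Fin 2 → ℤ, (if |((k 0 : ℤ) : ℝ)| ≤ (1 + 1 / 250) * L then (1 : ℝ) else 0) * c k ≤ s)
    (ho : ∑' k : Fin 2 → ℤ, (if 13 / 10 * |((k 0 : ℤ) : ℝ)| ≤ γ * |((k 1 : ℤ) : ℝ)| then (1 : ℝ) else 0) * c k ≤ o)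
    (hf₀ : ∑' k : Fin 2 → ℤ, (if R ≤ |((k 0 : ℤ) : ℝ)| then (1 : ℝ) else 0) * c k ≤ f₀)
    (hf₁ : ∑' k : Fin 2 → ℤ, (if R ≤ |((k 1 : ℤ) : ℝ)| then (1 : ℝ) else 0) * c k ≤ f₁)
    (hbudget : s + o + (f₀ + f₁) ≤ q ^ 2) :
    Real.sqrt (∑' k : Fin 2 → ℤ, (1 - Real.smoothTransition ((|((k 0 : ℤ) : ℝ)| - L) / (1 / 250 * L)) *
        (1 - Real.smoothTransition ((γ * |((k 1 : ℤ) : ℝ)| - 13 / 10 * |((k 0 : ℤ) : ℝ)|) / (1 / 20 * L))) *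
        ((1 - Real.smoothTransition ((|((k 0 : ℤ) : ℝ)| - R) / w)) *
          (1 - Real.smoothTransition ((|((k 1 : ℤ) : ℝ)| - R) / w)))) ^ 2 * c k) ≤ q := by
  have h3 := tsum_symProdS_sq_le_four_channels γ (13 / 10) (εs := 1 / 250) (εa := 1 / 20) (R := R)
    (by norm_num) (by norm_num) hL hw hc hc0
  calc Real.sqrt _ ≤ Real.sqrt (q ^ 2) := Real.sqrt_le_sqrt (by linarith)
    _ = q := Real.sqrt_sq hq

/-! ## §2 The crest deviation is a cell-end count -/

/-- **Deviation from the line average vanishes on flat points and is bounded by `2B` elsewhere**: if `|θ| ≤ B`, `M > 0`,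
`h = 1/(2M)`, and `G` is a measurable set of points `x` with `θ(x + u·v) = θ(x)` for all `|u| ≤ h` (the segment of
length `|v|/M` along `v` through `x` stays in one cell), then
`∫ (θ(x) − M∫_{−h}^{h} θ(x + u·v)du)² dx ≤ (2B)²·|Gᶜ|`. [folklore] -/
theorem integral_sq_sub_lineAvg_le {d : Type*} [Fintype d] {θ : UnitAddTorus d → ℝ} (hθ : Continuous θ) {B : ℝ}
    (hB : ∀ x, |θ x| ≤ B) (v : d → ℝ) {M : ℝ} (hM : 0 < M) {G : Set (UnitAddTorus d)} (hG : MeasurableSet G)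
    (hflat : ∀ x ∈ G, ∀ u ∈ Set.uIcc (-(1 / (2 * M))) (1 / (2 * M)),
      θ (x + fun j => (((u * v j : ℝ)) : UnitAddCircle)) = θ x) :
    ∫ x : UnitAddTorus d, (θ x - M * ∫ u in (-(1 / (2 * M)))..(1 / (2 * M)),
        θ (x + fun j => (((u * v j : ℝ)) : UnitAddCircle))) ^ 2 ≤ (2 * B) ^ 2 * volume.real Gᶜ := by
  set h : ℝ := 1 / (2 * M) with hh
  have hh0 : 0 < h := by positivity
  have hMh : M * (h - -h) = 1 := by rw [hh]; field_simp; ring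
  have hB0 : 0 ≤ B := (abs_nonneg _).trans (hB 0)
  -- the deviation as an average of increments
  have hdev : ∀ x : UnitAddTorus d, θ x - M * ∫ u in (-h)..h, θ (x + fun j => (((u * v j : ℝ)) : UnitAddCircle)) =
      M * ∫ u in (-h)..h, (θ x - θ (x + fun j => (((u * v j : ℝ)) : UnitAddCircle))) := by
    intro x
    have hci : IntervalIntegrable (fun u : ℝ => θ (x + fun j => (((u * v j : ℝ)) : UnitAddCircle))) volume (-h) h :=
      ((hθ.comp (continuous_const.add (continuous_pi fun _ =>
        (AddCircle.continuous_mk' (1 : ℝ)).comp (continuous_id.mul continuous_const)))).intervalIntegrable _ _)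
    rw [intervalIntegral.integral_sub intervalIntegrable_const hci, intervalIntegral.integral_const, smul_eq_mul, mul_sub,
      ← mul_assoc, hMh, one_mul]
  have hbound : ∀ x : UnitAddTorus d, |θ x - M * ∫ u in (-h)..h, θ (x + fun j => (((u * v j : ℝ)) : UnitAddCircle))| ≤ 2 * B := by
    intro x
    rw [hdev x, abs_mul, abs_of_pos hM]
    have h1 : ‖∫ u in (-h)..h, (θ x - θ (x + fun j => (((u * v j : ℝ)) : UnitAddCircle)))‖ ≤ (2 * B) * |h - -h| := by
      refine intervalIntegral.norm_integral_le_of_norm_le_const fun u _ => ?_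
      rw [Real.norm_eq_abs]
      calc |θ x - θ (x + fun j => (((u * v j : ℝ)) : UnitAddCircle))| ≤ |θ x| + |θ (x + fun j => (((u * v j : ℝ)) : UnitAddCircle))| :=
            abs_sub _ _
        _ ≤ B + B := add_le_add (hB _) (hB _)
        _ = 2 * B := by ring
    rw [Real.norm_eq_abs] at h1
    calc M * |∫ u in (-h)..h, (θ x - θ (x + fun j => (((u * v j : ℝ)) : UnitAddCircle)))| ≤ M * ((2 * B) * |h - -h|) :=
          mul_le_mul_of_nonneg_left h1 hM.le
      _ = 2 * B * (M * |h - -h|) := by ring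
      _ = 2 * B := by rw [abs_of_pos (by linarith), hMh, mul_one]
  have hzero : ∀ x ∈ G, θ x - M * ∫ u in (-h)..h, θ (x + fun j => (((u * v j : ℝ)) : UnitAddCircle)) = 0 := by
    intro x hx
    rw [hdev x]
    have h0 : ∫ u in (-h)..h, (θ x - θ (x + fun j => (((u * v j : ℝ)) : UnitAddCircle))) = ∫ u in (-h)..h, (0 : ℝ) := by
      refine intervalIntegral.integral_congr fun u hu => ?_
      simp only [hflat x hx u hu, sub_self]
    rw [h0, intervalIntegral.integral_const, smul_zero, mul_zero]
  -- compare with the indicator of `Gᶜ`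
  have hle : ∀ x : UnitAddTorus d, (θ x - M * ∫ u in (-h)..h, θ (x + fun j => (((u * v j : ℝ)) : UnitAddCircle))) ^ 2 ≤
      Gᶜ.indicator (fun _ => (2 * B) ^ 2) x := by
    intro x
    by_cases hx : x ∈ G
    · rw [hzero x hx, Set.indicator_of_notMem (Set.notMem_compl_iff.mpr hx)]; norm_num
    · rw [Set.indicator_of_mem (Set.mem_compl hx)]
      have h1 := hbound x
      rw [abs_le] at h1
      nlinarith [h1.1, h1.2]
  have hint : Integrable (Gᶜ.indicator fun _ : UnitAddTorus d => (2 * B) ^ 2) volume :=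
    (integrable_const _).indicator hG.compl
  calc ∫ x : UnitAddTorus d, (θ x - M * ∫ u in (-h)..h, θ (x + fun j => (((u * v j : ℝ)) : UnitAddCircle))) ^ 2
      ≤ ∫ x : UnitAddTorus d, Gᶜ.indicator (fun _ => (2 * B) ^ 2) x :=
        integral_mono_of_nonneg (Eventually.of_forall fun x => sq_nonneg _) hint (Eventually.of_forall hle)
    _ = (2 * B) ^ 2 * volume.real Gᶜ := by
        rw [integral_indicator hG.compl, setIntegral_const, smul_eq_mul, mul_comm]

/-- **Approximately flat crest segments** (the form the Gaussian-rounded cascade needs — `U_j = (tri ⋆ gauss_δ)` is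
nowhere exactly affine): if `|θ| ≤ B`, `M > 0`, `h = 1/(2M)`, and `G` is a measurable set of points `x` with
`|θ(x + u·v) − θ(x)| ≤ η` for all `|u| ≤ h`, then `∫ (θ(x) − M∫_{−h}^{h} θ(x + u·v)du)² dx ≤ η² + (2B)²·|Gᶜ|`. [folklore] -/
theorem integral_sq_sub_lineAvg_le_of_approx {d : Type*} [Fintype d] {θ : UnitAddTorus d → ℝ} (hθ : Continuous θ)
    {B : ℝ} (hB : ∀ x, |θ x| ≤ B) (v : d → ℝ) {M : ℝ} (hM : 0 < M) {η : ℝ} {G : Set (UnitAddTorus d)}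
    (hG : MeasurableSet G)
    (happrox : ∀ x ∈ G, ∀ u ∈ Set.uIcc (-(1 / (2 * M))) (1 / (2 * M)),
      |θ (x + fun j => (((u * v j : ℝ)) : UnitAddCircle)) - θ x| ≤ η) :
    ∫ x : UnitAddTorus d, (θ x - M * ∫ u in (-(1 / (2 * M)))..(1 / (2 * M)),
        θ (x + fun j => (((u * v j : ℝ)) : UnitAddCircle))) ^ 2 ≤ η ^ 2 + (2 * B) ^ 2 * volume.real Gᶜ := by
  set h : ℝ := 1 / (2 * M) with hh
  have hh0 : 0 < h := by positivity
  have hMh : M * (h - -h) = 1 := by rw [hh]; field_simp; ring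
  have hB0 : 0 ≤ B := (abs_nonneg _).trans (hB 0)
  have hci : ∀ x : UnitAddTorus d,
      IntervalIntegrable (fun u : ℝ => θ (x + fun j => (((u * v j : ℝ)) : UnitAddCircle))) volume (-h) h := fun x =>
    ((hθ.comp (continuous_const.add (continuous_pi fun _ =>
      (AddCircle.continuous_mk' (1 : ℝ)).comp (continuous_id.mul continuous_const)))).intervalIntegrable _ _)
  have hdev : ∀ x : UnitAddTorus d, θ x - M * ∫ u in (-h)..h, θ (x + fun j => (((u * v j : ℝ)) : UnitAddCircle)) =
      M * ∫ u in (-h)..h, (θ x - θ (x + fun j => (((u * v j : ℝ)) : UnitAddCircle))) := by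
    intro x
    rw [intervalIntegral.integral_sub intervalIntegrable_const (hci x), intervalIntegral.integral_const, smul_eq_mul, mul_sub,
      ← mul_assoc, hMh, one_mul]
  -- `|dev| ≤ C` whenever the increments are `≤ C` on the segment
  have hdevle : ∀ x : UnitAddTorus d, ∀ C : ℝ, (∀ u ∈ Set.uIcc (-h) h,
      |θ x - θ (x + fun j => (((u * v j : ℝ)) : UnitAddCircle))| ≤ C) →
      |θ x - M * ∫ u in (-h)..h, θ (x + fun j => (((u * v j : ℝ)) : UnitAddCircle))| ≤ C := by
    intro x C hC
    rw [hdev x, abs_mul, abs_of_pos hM]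
    have h1 : ‖∫ u in (-h)..h, (θ x - θ (x + fun j => (((u * v j : ℝ)) : UnitAddCircle)))‖ ≤ C * |h - -h| := by
      refine intervalIntegral.norm_integral_le_of_norm_le_const fun u hu => ?_
      rw [Real.norm_eq_abs]
      exact hC u (Set.uIoc_subset_uIcc hu)
    rw [Real.norm_eq_abs] at h1
    calc M * |∫ u in (-h)..h, (θ x - θ (x + fun j => (((u * v j : ℝ)) : UnitAddCircle)))| ≤ M * (C * |h - -h|) :=
          mul_le_mul_of_nonneg_left h1 hM.le
      _ = C * (M * |h - -h|) := by ring
      _ = C := by rw [abs_of_pos (by linarith), hMh, mul_one]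
  have hbound : ∀ x : UnitAddTorus d,
      |θ x - M * ∫ u in (-h)..h, θ (x + fun j => (((u * v j : ℝ)) : UnitAddCircle))| ≤ 2 * B := fun x =>
    hdevle x (2 * B) fun u _ => by
      calc |θ x - θ (x + fun j => (((u * v j : ℝ)) : UnitAddCircle))|
          ≤ |θ x| + |θ (x + fun j => (((u * v j : ℝ)) : UnitAddCircle))| := abs_sub _ _
        _ ≤ B + B := add_le_add (hB _) (hB _)
        _ = 2 * B := by ring
  have hgood : ∀ x ∈ G, |θ x - M * ∫ u in (-h)..h, θ (x + fun j => (((u * v j : ℝ)) : UnitAddCircle))| ≤ η :=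
    fun x hx => hdevle x η fun u hu => by rw [abs_sub_comm]; exact happrox x hx u hu
  have hle : ∀ x : UnitAddTorus d, (θ x - M * ∫ u in (-h)..h, θ (x + fun j => (((u * v j : ℝ)) : UnitAddCircle))) ^ 2 ≤
      η ^ 2 + Gᶜ.indicator (fun _ => (2 * B) ^ 2) x := by
    intro x
    by_cases hx : x ∈ G
    · rw [Set.indicator_of_notMem (Set.notMem_compl_iff.mpr hx), add_zero]
      have h1 := hgood x hx
      rw [abs_le] at h1
      nlinarith [h1.1, h1.2]
    · rw [Set.indicator_of_mem (Set.mem_compl hx)]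
      have h1 := hbound x
      rw [abs_le] at h1
      nlinarith [h1.1, h1.2, sq_nonneg η]
  have hint : Integrable (fun x : UnitAddTorus d => η ^ 2 + Gᶜ.indicator (fun _ => (2 * B) ^ 2) x) volume :=
    (integrable_const _).add ((integrable_const _).indicator hG.compl)
  calc ∫ x : UnitAddTorus d, (θ x - M * ∫ u in (-h)..h, θ (x + fun j => (((u * v j : ℝ)) : UnitAddCircle))) ^ 2
      ≤ ∫ x : UnitAddTorus d, (η ^ 2 + Gᶜ.indicator (fun _ => (2 * B) ^ 2) x) :=
        integral_mono_of_nonneg (Eventually.of_forall fun x => sq_nonneg _) hint (Eventually.of_forall hle)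
    _ = η ^ 2 + (2 * B) ^ 2 * volume.real Gᶜ := by
        rw [integral_add (integrable_const _) ((integrable_const _).indicator hG.compl), integral_const, probReal_univ,
          one_smul, integral_indicator hG.compl, setIntegral_const, smul_eq_mul, mul_comm]

end Summit.AnomalousDissipation.AnomalousDissipation.Theorems.SawtoothPulseCascade.K1Start
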